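import Literature.Combinatorics.Sahi2008.MeasureFunctional
import Literature.Combinatorics.Sahi2008.Rectangles
import HarnessLib

/-!
# Lieb–Sahi (2022), Theorem 3.5 as printed: the `n`-function inequality for `k`-rectangles, Lebesgue measure

Topic `Literature/Combinatorics/Sahi2008` (sequel of `Rectangles.lean` — Theorem 3.5 in discrete form,
`LiebSahiBox.liebSahi_thm35`: boxes of the grid `{0,…,M}^κ` under the uniform product weight — and of
`MeasureFunctional.lean` — the measure-level functional `msahiE`, its moment polynomial `momentE`,
`continuous_momentE`).

## Source (read 2026-08-20 from the materialised arXiv text, corpus `paper:arxiv-2107.09838`, pp. 5, 7–8)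

E. H. Lieb, S. Sahi, *On the extension of the FKG inequality to `n` functions*, J. Math. Phys. **63** (2022)
043301 = arXiv:2107.09838 [LiebSahi2021], §3.3 "Proof of the `n` function inequality for rectangles in any
dimension" (the hypercube `Q_k = [0,1]^k` "equipped with the Lebesgue measure and the usual partial order", §2):
> "By a rectangle in dimension `k`, or a `k`-rectangle, we mean a subset of `[0,1]^k` of the form
> `[0,r_1] × ⋯ × [0,r_k]`, `0 ≤ r_1,…,r_k ≤ 1`.
> **THEOREM 3.5.** If `f^i` are characteristic functions of `k`-rectangles then `E_n(f^1,…,f^n) ≥ 0`."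

## What is here (everything PROVED; no named facts; axioms standard)

`liebSahi_thm35_volume`: for Lebesgue measure `volume` on `κ → unitInterval` (`κ` a finite index type,
`|κ| = k`), every `n` and all corners `r^0,…,r^{n−1} ∈ [0,1]^κ`,
`0 ≤ E_n(χ_{R(r^0)},…,χ_{R(r^{n−1})})`, `R(r) = {x : x_j ≤ r_j ∀ j} = [0,r_1] × ⋯ × [0,r_k]` — Theorem 3.5
AS PRINTED (the tree's `Rectangles.lean` had it with `[0,1]^k` replaced by a finite grid).

## Proof (limit passage onto the discrete theorem; cf. [LiebSahi2021, Lemma 2.3])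

`E_n` is a fixed continuous polynomial in the joint moments (`msahiE_eq_momentE`, `sahiE_eq_momentE`,
`continuous_momentE`).  The Lebesgue joint moment of `{χ_{R(r^i)}}_{i∈S}` is `Π_j λ{y : y ≤ r^i_j ∀ i ∈ S}`
(`= Π_j min_{i∈S} r^i_j`).  On the grid `{0,…,M+1}^κ` with its uniform weight take the boxes with levels
`ρ^i_j = ⌊(M+1) r^i_j⌋`; their joint moment is `Π_j N_j/(M+2)` with `N_j = #{b ≤ M+1 : b ≤ ⌊(M+1) r^i_j⌋ ∀ i ∈ S}`
(`LiebSahiBox.ex_prod_setInd_box`), and `|N_j/(M+2) − λ{y ≤ r^i_j ∀ i ∈ S}| ≤ 1/(M+2)`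
(`abs_countFrac_sub_volume_le`).  So the grid moments converge to the Lebesgue moments, and
`E_n^{Leb} = lim_M E_n^{grid} ≥ 0` by `LiebSahiBox.liebSahi_thm35`.
-/

noncomputable section

namespace Literature.Combinatorics.Sahi2008

open Finset Function MeasureTheory Set Filter Topology
open scoped unitInterval

namespace LebesgueBoxes

variable {κ : Type*} [Fintype κ] {n : ℕ}

/-! ### The rectangles and their indicators -/

/-- The `k`-rectangle `R(r) = [0,r_1] × ⋯ × [0,r_k] = {x : x_j ≤ r_j ∀ j}` of `[0,1]^κ`.
[cite: LiebSahi2021, §3.3 (k-rectangles)] -/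
def rect (r : κ → I) : Set (κ → I) := {x | ∀ j, x j ≤ r j}

/-- The one-dimensional section `{y ∈ [0,1] : y ≤ c_i ∀ i ∈ S}` (an initial segment). [cite: LiebSahi2021, §3.3, eq. (3.9)] -/
def sect (S : Finset (Fin n)) (c : Fin n → I) : Set I := {y | ∀ i ∈ S, y ≤ c i}

/-- The section is measurable (plumbing). [folklore] -/
private theorem measurableSet_sect (S : Finset (Fin n)) (c : Fin n → I) : MeasurableSet (sect S c) := by
  have h : sect S c = ⋂ i ∈ S, Set.Iic (c i) := by
    ext y
    simp only [sect, Set.mem_setOf_eq, Set.mem_iInter, Set.mem_Iic]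
  rw [h]
  exact S.measurableSet_biInter fun i _ => measurableSet_Iic

/-- A finite product of indicator functions is the indicator of the intersection (plumbing). [folklore] -/
private theorem prod_indicator_one {X : Type*} (S : Finset (Fin n)) (A : Fin n → Set X) :
    ∏ i ∈ S, (A i).indicator (1 : X → ℝ) = (⋂ i ∈ S, A i).indicator 1 := by
  classical
  induction S using Finset.induction_on with
  | empty => simp
  | insert a S ha ih =>
    rw [Finset.prod_insert ha, ih, Finset.set_biInter_insert, Set.inter_indicator_one]

omit [Fintype κ] in
/-- The intersection of rectangles over `S` is the product of the sections (plumbing). [folklore] -/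
private theorem biInter_rect (S : Finset (Fin n)) (r : Fin n → κ → I) :
    (⋂ i ∈ S, rect (r i)) = Set.pi Set.univ fun j => sect S fun i => r i j := by
  ext x
  simp only [rect, sect, Set.mem_iInter, Set.mem_setOf_eq, Set.mem_pi, Set.mem_univ, true_implies]
  exact ⟨fun h j i hi => h i hi j, fun h i hi j => h j i hi⟩

/-- **The Lebesgue joint moments of rectangle indicators**: `∫ Π_{i∈S} χ_{R(r^i)} dλ = Π_j λ(sect_j)`
(Lieb–Sahi's (3.9) iterated over the coordinates). [cite: LiebSahi2021, §3.3, eq. (3.9)] -/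
theorem integral_prod_indicator_rect (S : Finset (Fin n)) (r : Fin n → κ → I) :
    ∫ x, (∏ i ∈ S, (rect (r i)).indicator (1 : (κ → I) → ℝ)) x ∂volume =
      ∏ j, volume.real (sect S fun i => r i j) := by
  have hmeas : MeasurableSet (Set.pi Set.univ fun j => sect S fun i => r i j) :=
    MeasurableSet.univ_pi fun j => measurableSet_sect S _
  rw [prod_indicator_one, biInter_rect, integral_indicator_one hmeas, measureReal_def, volume_pi_pi,
    ENNReal.toReal_prod]
  rfl

/-! ### The grid side -/

/-- The grid level `⌊(M+1) c⌋ ∈ {0,…,M+1}` of a threshold `c ∈ [0,1]`. [cite: LiebSahi2021, Lemma 2.3 (proof)] -/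
def level (M : ℕ) (c : I) : Fin (M + 2) :=
  ⟨⌊((M : ℝ) + 1) * c⌋₊, by
    have h : ((M : ℝ) + 1) * c ≤ (M : ℝ) + 1 := by
      have := c.2.2
      nlinarith
    have h' : ⌊((M : ℝ) + 1) * c⌋₊ ≤ M + 1 := by
      refine Nat.floor_le_of_le ?_
      push_cast
      exact h
    omega⟩

/-- The grid boxes approximating the rectangles: levels `ρ^i_j = ⌊(M+1) r^i_j⌋`. [cite: LiebSahi2021, Lemma 2.3 (proof)] -/
def gridLevels (M : ℕ) (r : Fin n → κ → I) (i : Fin n) : κ → Fin (M + 2) := fun j => level M (r i j)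

/-- The count `N = #{b ∈ {0,…,M+1} : b ≤ ⌊(M+1) c_i⌋ ∀ i ∈ S}`. [cite: LiebSahi2021, Lemma 2.3 (proof)] -/
def count (M : ℕ) (S : Finset (Fin n)) (c : Fin n → I) : ℕ :=
  #{b : Fin (M + 2) | ∀ i ∈ S, (b : ℕ) ≤ ⌊((M : ℝ) + 1) * c i⌋₊}

omit [Fintype κ] in
/-- The marginal distribution function of the uniform chain `{0,…,M+1}` at the infimum of the levels is
`N/(M+2)` (plumbing). [folklore] -/
private theorem cdf_uniform_inf [DecidableEq κ] (M : ℕ) (S : Finset (Fin n)) (r : Fin n → κ → I) (j : κ) :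
    LiebSahiBox.cdf (LiebSahiBox.uniformChain κ (M + 1)) j ((S.inf (gridLevels M r)) j) =
      (count M S fun i => r i j : ℝ) / ((M : ℝ) + 2) := by
  rw [LiebSahiBox.cdf]
  simp only [LiebSahiBox.uniformChain, sum_const, nsmul_eq_mul]
  have hfilter : (univ.filter fun b : Fin (M + 2) => (b : ℕ) ≤ ((S.inf (gridLevels M r)) j : ℕ)) =
      univ.filter fun b : Fin (M + 2) => ∀ i ∈ S, (b : ℕ) ≤ ⌊((M : ℝ) + 1) * r i j⌋₊ := by
    refine Finset.filter_congr fun b _ => ?_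
    rw [Finset.inf_apply, ← Fin.le_iff_val_le_val, Finset.le_inf_iff]
    refine forall₂_congr fun i _ => ?_
    rw [Fin.le_iff_val_le_val]
    rfl
  rw [hfilter, count]
  push_cast
  ring

/-- **The grid joint moments of the approximating boxes**: `E_grid(Π_{i∈S} χ_{B(ρ^i)}) = Π_j N_j/(M+2)`.
[cite: LiebSahi2021, §3.3, eq. (3.9) and Lemma 2.3] -/
theorem ex_prod_setInd_gridBox [DecidableEq κ] (M : ℕ) (S : Finset (Fin n)) (r : Fin n → κ → I) :
    ex (LiebSahiBox.chainProdWeight (LiebSahiBox.uniformChain κ (M + 1)))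
        (∏ i ∈ S, setInd (LiebSahiBox.box (gridLevels M r i))) =
      ∏ j, ((count M S fun i => r i j : ℝ) / ((M : ℝ) + 2)) := by
  rw [LiebSahiBox.ex_prod_setInd_box]
  exact Finset.prod_congr rfl fun j _ => cdf_uniform_inf M S r j

/-! ### One coordinate: the count is a Riemann sum for the section -/

/-- **`|N/(M+2) − λ(sect)| ≤ 1/(M+2)`**: the fraction of grid points `b/(M+1)`, `b = 0,…,M+1`, lying in the
initial segment `{y : y ≤ c_i ∀ i ∈ S}` differs from its length by at most one grid weight.
[cite: LiebSahi2021, Lemma 2.3 (proof)] -/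
theorem abs_countFrac_sub_volume_le (M : ℕ) (S : Finset (Fin n)) (c : Fin n → I) :
    |(count M S c : ℝ) / ((M : ℝ) + 2) - volume.real (sect S c)| ≤ 1 / ((M : ℝ) + 2) := by
  have hM : (0 : ℝ) < (M : ℝ) + 2 := by positivity
  rcases S.eq_empty_or_nonempty with hS | hS
  · -- empty `S`: the section is everything, the count is `M + 2`
    subst hS
    have hsect : sect (∅ : Finset (Fin n)) c = Set.univ := by
      ext y; simp [sect]
    have hcount : count M (∅ : Finset (Fin n)) c = M + 2 := by
      simp [count]
    rw [hsect, hcount, probReal_univ]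
    push_cast
    rw [div_self hM.ne', sub_self, abs_zero]
    positivity
  · -- nonempty `S`: the section is `[0, u]`, `u = min c_i`, and the count is `⌊(M+1)u⌋ + 1`
    set u : I := S.inf' hS c with hu
    have hsect : sect S c = Set.Iic u := by
      ext y
      simp only [sect, Set.mem_setOf_eq, Set.mem_Iic, hu, Finset.le_inf'_iff]
    have hvol : volume.real (sect S c) = (u : ℝ) := by
      rw [hsect, measureReal_def, unitInterval.volume_Iic, ENNReal.toReal_ofReal u.2.1]
    -- the minimum of the levels is the level of the minimum
    set K : ℕ := ⌊((M : ℝ) + 1) * u⌋₊ with hK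
    have hmono : Monotone fun y : I => ⌊((M : ℝ) + 1) * y⌋₊ := fun y y' hyy' =>
      Nat.floor_le_floor (mul_le_mul_of_nonneg_left (Subtype.coe_le_coe.2 hyy') (by positivity))
    have hKle : ∀ i ∈ S, K ≤ ⌊((M : ℝ) + 1) * c i⌋₊ := fun i hi => hmono (Finset.inf'_le c hi)
    obtain ⟨i₀, hi₀, hui₀⟩ := Finset.exists_mem_eq_inf' hS c
    have hKeq : ∀ b : ℕ, (∀ i ∈ S, b ≤ ⌊((M : ℝ) + 1) * c i⌋₊) ↔ b ≤ K := by
      intro b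
      constructor
      · intro h
        have := h i₀ hi₀
        rwa [hK, hu, hui₀]
      · intro h i hi
        exact h.trans (hKle i hi)
    have hKM : K ≤ M + 1 := by
      have h : ((M : ℝ) + 1) * u ≤ (M : ℝ) + 1 := by
        have := u.2.2
        nlinarith
      refine Nat.floor_le_of_le ?_
      push_cast
      exact h
    have hcount : count M S c = K + 1 := by
      rw [count]
      have hf : (univ.filter fun b : Fin (M + 2) => ∀ i ∈ S, (b : ℕ) ≤ ⌊((M : ℝ) + 1) * c i⌋₊) =
          Finset.Iic (⟨K, by omega⟩ : Fin (M + 2)) := by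
        ext b
        simp only [Finset.mem_filter, Finset.mem_univ, true_and, Finset.mem_Iic, hKeq,
          Fin.le_iff_val_le_val]
      rw [hf, Fin.card_Iic]
    have hx : (0 : ℝ) ≤ ((M : ℝ) + 1) * u := mul_nonneg (by positivity) u.2.1
    have h1 : (K : ℝ) ≤ ((M : ℝ) + 1) * u := Nat.floor_le hx
    have h2 : ((M : ℝ) + 1) * u < (K : ℝ) + 1 := Nat.lt_floor_add_one _
    have hu0 : (0 : ℝ) ≤ u := u.2.1
    have hu1 : (u : ℝ) ≤ 1 := u.2.2
    rw [hvol, hcount]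
    push_cast
    have hd : ((K : ℝ) + 1) / ((M : ℝ) + 2) - u = (((K : ℝ) + 1) - u * ((M : ℝ) + 2)) / ((M : ℝ) + 2) := by
      field_simp
    rw [hd, abs_div, abs_of_pos hM, div_le_div_iff_of_pos_right hM, abs_le]
    constructor <;> nlinarith

/-- The grid fractions converge to the lengths of the sections (one coordinate).
[cite: LiebSahi2021, Lemma 2.3 (proof)] -/
theorem tendsto_countFrac (S : Finset (Fin n)) (c : Fin n → I) :
    Tendsto (fun M : ℕ => (count M S c : ℝ) / ((M : ℝ) + 2)) atTop (𝓝 (volume.real (sect S c))) := by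
  have h0 : Tendsto (fun M : ℕ => 1 / ((M : ℝ) + 2)) atTop (𝓝 0) := by
    have h := (tendsto_const_div_atTop_nhds_zero_nat (1 : ℝ)).comp (tendsto_add_atTop_nat 2)
    refine h.congr fun M => ?_
    simp only [Function.comp_apply, Nat.cast_add, Nat.cast_ofNat]
  rw [tendsto_iff_norm_sub_tendsto_zero]
  refine squeeze_zero (fun M => norm_nonneg _) (fun M => ?_) h0
  rw [Real.norm_eq_abs]
  exact abs_countFrac_sub_volume_le M S c

/-- **The grid joint moments converge to the Lebesgue joint moments.** [cite: LiebSahi2021, Lemma 2.3] -/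
theorem tendsto_gridMoment [DecidableEq κ] (S : Finset (Fin n)) (r : Fin n → κ → I) :
    Tendsto (fun M : ℕ => ex (LiebSahiBox.chainProdWeight (LiebSahiBox.uniformChain κ (M + 1)))
        (∏ i ∈ S, setInd (LiebSahiBox.box (gridLevels M r i)))) atTop
      (𝓝 (∫ x, (∏ i ∈ S, (rect (r i)).indicator (1 : (κ → I) → ℝ)) x ∂volume)) := by
  simp only [ex_prod_setInd_gridBox, integral_prod_indicator_rect]
  exact tendsto_finsetProd _ fun j _ => tendsto_countFrac S fun i => r i j

end LebesgueBoxes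

open LebesgueBoxes

/-- **Lieb–Sahi's Theorem 3.5, as printed**: for Lebesgue measure on `[0,1]^k` (`κ → unitInterval`, `κ` finite)
and every `n`, if `f^i = χ_{R(r^i)}` are characteristic functions of `k`-rectangles
`R(r) = [0,r_1] × ⋯ × [0,r_k]` then `E_n(f^1,…,f^n) ≥ 0`.  (Limit passage from the tree's discrete Theorem 3.5
`LiebSahiBox.liebSahi_thm35` through the continuity of the moment polynomial.) [cite: LiebSahi2021, Thm. 3.5] -/
theorem liebSahi_thm35_volume {κ : Type*} [Fintype κ] (n : ℕ) (r : Fin n → κ → I) :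
    0 ≤ msahiE (volume : Measure (κ → I)) n fun i => (rect (r i)).indicator (1 : (κ → I) → ℝ) := by
  classical
  set Mo : Finset (Fin n) → ℝ := fun S => ∫ x, (∏ i ∈ S, (rect (r i)).indicator (1 : (κ → I) → ℝ)) x ∂volume
    with hMo
  have hE : msahiE (volume : Measure (κ → I)) n (fun i => (rect (r i)).indicator (1 : (κ → I) → ℝ)) =
      momentE n Mo := msahiE_eq_momentE _ n _
  have hlim : Tendsto (fun M : ℕ => momentE n fun S =>
      ex (LiebSahiBox.chainProdWeight (LiebSahiBox.uniformChain κ (M + 1)))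
        (∏ i ∈ S, setInd (LiebSahiBox.box (gridLevels M r i)))) atTop (𝓝 (momentE n Mo)) :=
    ((continuous_momentE n).tendsto Mo).comp (tendsto_pi_nhds.2 fun S => tendsto_gridMoment S r)
  have hpos : ∀ M : ℕ, 0 ≤ momentE n fun S =>
      ex (LiebSahiBox.chainProdWeight (LiebSahiBox.uniformChain κ (M + 1)))
        (∏ i ∈ S, setInd (LiebSahiBox.box (gridLevels M r i))) := by
    intro M
    rw [← sahiE_eq_momentE]
    exact LiebSahiBox.liebSahi_thm35 n (gridLevels M r)
  rw [hE]
  exact ge_of_tendsto' hlim hpos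

/-- Theorem 3.5 for `k = 1`, on the unit interval itself: `E_n(χ_{[0,a_1]},…,χ_{[0,a_n]}) ≥ 0` for Lebesgue
measure on `[0,1]` (Lieb–Sahi's Lemma 3.2 gives the explicit value `a_1(1−a_2)⋯(n−1−a_n)` for sorted `a`; only
the sign is recorded here, transported from `Unit → [0,1]` along the evaluation map).
[cite: LiebSahi2021, Lemma 3.2 and Thm. 3.5] -/
theorem msahiE_volume_unitInterval_indicator_Iic_nonneg (n : ℕ) (a : Fin n → I) :
    0 ≤ msahiE (volume : Measure I) n fun i => (Set.Iic (a i)).indicator (1 : I → ℝ) := by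
  have hφ : MeasurePreserving (MeasurableEquiv.funUnique Unit I) (volume : Measure (Unit → I)) volume :=
    volume_preserving_funUnique Unit I
  rw [← msahiE_comp_measurePreserving hφ (MeasurableEquiv.funUnique Unit I).measurableEmbedding n]
  have h : (fun i => (Set.Iic (a i)).indicator (1 : I → ℝ) ∘ (MeasurableEquiv.funUnique Unit I)) =
      fun i => (rect fun _ : Unit => a i).indicator (1 : (Unit → I) → ℝ) := by
    funext i x
    simp only [Function.comp_apply, Set.indicator_apply, Set.mem_Iic, rect, Set.mem_setOf_eq,
      MeasurableEquiv.funUnique_apply, Pi.one_apply]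
    by_cases hx : x () ≤ a i
    · rw [if_pos hx, if_pos fun _ => hx]
    · rw [if_neg hx, if_neg fun h' => hx (h' ())]
  rw [h]
  exact liebSahi_thm35_volume n fun i _ => a i

end Literature.Combinatorics.Sahi2008
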